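import Literature.NumberTheory.Automorphic.AdicCompletionDegreeOnePlaceEquiv
import Mathlib.NumberTheory.Padics.HeightOneSpectrum
import HarnessLib

/-!
# `𝒪_w ≅ ℤ_p` at a finite place of degree one of a number field

Topic `NumberTheory/NumberFields`; namespace `Literature.NumberTheory.NumberFields`.  DEFINITIONS WITH BODIES
(named ring isomorphisms) and theorems; no named fact, no instance, no `sorry`.

For a number field `K`, a finite place `w` of `K` above the place `v` of `ℚ` with `e(w|v) = f(w|v) = 1`
(DEGREE ONE: `K_w = ℚ_p`, `𝒪_w = ℤ_p` — e.g. a prime of an imaginary quadratic field above a SPLIT rational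
prime, de Shalit's standing situation `𝒪_𝔭 = ℤ_p`, *Iwasawa theory of elliptic curves with CM* II.1.1,
I.3.3), the ring of integers of the completion is `ℤ_p`:

* `adicCompletionIntegersEquivOfDegreeOne K v w he hf : w.adicCompletionIntegers K ≃+* v.adicCompletionIntegers ℚ`
  — the restriction to the valuation rings of the inverse of the tree's
  `Literature.NumberTheory.Automorphic.adicCompletionEquivOfDegreeOne ℚ K v w he hf : ℚ_v ≃+* K_w`
  (`AdicCompletionDegreeOnePlaceEquiv.lean`, which maps `𝒪_v` onto `𝒪_w`), continuous both ways;
* ★ `padicIntEquivOfDegreeOne K p w he hf : w.adicCompletionIntegers K ≃+* ℤ_[p]` for `w` above the place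
  `(p)` of `ℚ` (instance argument `w.asIdeal.LiesOver (ratPlace p).asIdeal`, `ratPlace p := primesEquiv.symm p`)
  — composed with Mathlib's `ℚ`-case `PadicInt.adicCompletionIntegersEquiv : ℤ_[p] ≃A[ℤ] 𝒪_{(p)}(ℚ)`;
  continuous both ways;
* `liesOver_ratPlace_of_natCast_mem` (`p ∈ w ⟹ w` lies over `(p)`), so that a consumer holding
  `(p : 𝓞 K) ∈ w.asIdeal`, `e(w|p) = 1`, `f(w|p) = 1` gets
  ★★ `padicIntEquivOfNatCastMem K w hpw he hf : w.adicCompletionIntegers K ≃+* ℤ_[p]`.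

This is the input «`e : 𝒪_v ≃+* ℤ_[p]`» of the ray-class-tower character files
(`RayClassFieldAdicCharacterTower.lean`, cell `bsd-print-cf2`: `mem_rayAdicTower_iff … (e : 𝒪_v ≃+* ℤ_[p])`),
there taken as a variable.  Mathlib has the case `K = ℚ` only (`padicIntEquiv`); the other-summit file
`Summits/Ventures/HodgeRepro2/T5DegreeOneIntegers.lean` proves the same isomorphism from scratch under
`import Mathlib`; this is its Literature-level home built on the tree's degree-one equivalence.

## References

* A. Fröhlich, M. J. Taylor, *Algebraic number theory* (1993), Ch. III §1 (1.14)(a) (`[K_w : F_v] = e f`).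
  [FrohlichTaylor1990]
* E. de Shalit, *Iwasawa theory of elliptic curves with complex multiplication* (1987), I.3.3, II.1.1
  (`𝒪_𝔭 = ℤ_p` at a split prime). [deShalit1987]
-/

set_option autoImplicit false

noncomputable section

open IsDedekindDomain NumberField Rat.HeightOneSpectrum
open Literature.NumberTheory.Automorphic

namespace Literature.NumberTheory.NumberFields

/-! ### §1 `𝒪_w ≃+* 𝒪_v(ℚ)` at a place of degree one -/

section DegreeOne

variable (K : Type) [Field K] [NumberField K] (v : HeightOneSpectrum (𝓞 ℚ)) (w : HeightOneSpectrum (𝓞 K))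
  [w.asIdeal.LiesOver v.asIdeal]
  (he : w.asIdeal.ramificationIdx (𝓞 ℚ) = 1) (hf : w.asIdeal.inertiaDeg (𝓞 ℚ) = 1)

/-- **`𝒪_w ≃+* 𝒪_v(ℚ)` at a place of degree one**: the restriction to the valuation rings of the inverse of
the tree's `ℚ_v ≃+* K_w` (`adicCompletionEquivOfDegreeOne`, which preserves `Valued.v`).
[cite: FrohlichTaylor1990, Ch. III §1 (1.14)(a)] -/
def adicCompletionIntegersEquivOfDegreeOne :
    w.adicCompletionIntegers K ≃+* v.adicCompletionIntegers ℚ :=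
  (adicCompletionEquivOfDegreeOne ℚ K v w he hf).symm.restrict (w.adicCompletionIntegers K)
    (v.adicCompletionIntegers ℚ) fun x ↦ by
      conv_lhs => rw [← (adicCompletionEquivOfDegreeOne ℚ K v w he hf).apply_symm_apply x]
      exact mem_adicCompletionIntegers_iff_of_degree_one ℚ K v w he hf _

/-- Underlying elements: `(e x : ℚ_v) = (ℚ_v ≃+* K_w)⁻¹ x`. [cite: FrohlichTaylor1990, Ch. III §1 (1.14)(a)] -/
@[simp] theorem coe_adicCompletionIntegersEquivOfDegreeOne_apply (x : w.adicCompletionIntegers K) :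
    ((adicCompletionIntegersEquivOfDegreeOne K v w he hf x : v.adicCompletionIntegers ℚ) : v.adicCompletion ℚ) =
      (adicCompletionEquivOfDegreeOne ℚ K v w he hf).symm (x : w.adicCompletion K) := rfl

/-- Underlying elements of the inverse: `(e⁻¹ y : K_w) = (ℚ_v ≃+* K_w) y`. [cite: FrohlichTaylor1990, Ch. III §1 (1.14)(a)] -/
@[simp] theorem coe_adicCompletionIntegersEquivOfDegreeOne_symm_apply (y : v.adicCompletionIntegers ℚ) :
    (((adicCompletionIntegersEquivOfDegreeOne K v w he hf).symm y : w.adicCompletionIntegers K) :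
        w.adicCompletion K) =
      adicCompletionEquivOfDegreeOne ℚ K v w he hf (y : v.adicCompletion ℚ) := rfl

/-- `𝒪_w ≃+* 𝒪_v(ℚ)` is continuous. [cite: FrohlichTaylor1990, Ch. III §1 (1.14)(a)] -/
theorem continuous_adicCompletionIntegersEquivOfDegreeOne :
    Continuous (adicCompletionIntegersEquivOfDegreeOne K v w he hf) :=
  Continuous.subtype_mk
    ((continuous_adicCompletionEquivOfDegreeOne_symm ℚ K v w he hf).comp continuous_subtype_val) _

/-- Its inverse is continuous. [cite: FrohlichTaylor1990, Ch. III §1 (1.14)(a)] -/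
theorem continuous_adicCompletionIntegersEquivOfDegreeOne_symm :
    Continuous (adicCompletionIntegersEquivOfDegreeOne K v w he hf).symm :=
  Continuous.subtype_mk
    ((continuous_adicCompletionEquivOfDegreeOne ℚ K v w he hf).comp continuous_subtype_val) _

end DegreeOne

/-! ### §2 `𝒪_w ≃+* ℤ_[p]` for `w` of degree one above the rational prime `p` -/

section Padic

variable (K : Type) [Field K] [NumberField K] (p : ℕ) [hp : Fact p.Prime]

/-- The place `(p)` of `ℚ` (Mathlib's `primesEquiv.symm p`). [cite: FrohlichTaylor1990, Ch. III §1 (1.14)(a)] -/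
abbrev ratPlace : HeightOneSpectrum (𝓞 ℚ) := (primesEquiv (R := 𝓞 ℚ)).symm ⟨p, hp.out⟩

variable (w : HeightOneSpectrum (𝓞 K)) [w.asIdeal.LiesOver (ratPlace p).asIdeal]
  (he : w.asIdeal.ramificationIdx (𝓞 ℚ) = 1) (hf : w.asIdeal.inertiaDeg (𝓞 ℚ) = 1)

/-- ★ **`𝒪_w ≃+* ℤ_[p]` at a place of degree one above `p`**: de Shalit's `𝒪_𝔭 = ℤ_p` at a split prime —
§1 composed with Mathlib's `ℚ`-case `PadicInt.adicCompletionIntegersEquiv : ℤ_[p] ≃A[ℤ] 𝒪_{(p)}(ℚ)`.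
[cite: deShalit1987, I.3.3 (p. 17), II.1.1 (p. 32)] [cite: FrohlichTaylor1990, Ch. III §1 (1.14)(a)] -/
def padicIntEquivOfDegreeOne : w.adicCompletionIntegers K ≃+* ℤ_[p] :=
  (adicCompletionIntegersEquivOfDegreeOne K (ratPlace p) w he hf).trans
    (PadicInt.adicCompletionIntegersEquiv (R := 𝓞 ℚ) ⟨p, hp.out⟩).symm.toAlgEquiv.toRingEquiv

/-- `𝒪_w ≃+* ℤ_[p]` is continuous. [cite: FrohlichTaylor1990, Ch. III §1 (1.14)(a)] -/
theorem continuous_padicIntEquivOfDegreeOne : Continuous (padicIntEquivOfDegreeOne K p w he hf) :=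
  (PadicInt.adicCompletionIntegersEquiv (R := 𝓞 ℚ) ⟨p, hp.out⟩).symm.continuous.comp
    (continuous_adicCompletionIntegersEquivOfDegreeOne K (ratPlace p) w he hf)

/-- Its inverse `ℤ_[p] ≃+* 𝒪_w` is continuous. [cite: FrohlichTaylor1990, Ch. III §1 (1.14)(a)] -/
theorem continuous_padicIntEquivOfDegreeOne_symm : Continuous (padicIntEquivOfDegreeOne K p w he hf).symm :=
  (continuous_adicCompletionIntegersEquivOfDegreeOne_symm K (ratPlace p) w he hf).comp
    (PadicInt.adicCompletionIntegersEquiv (R := 𝓞 ℚ) ⟨p, hp.out⟩).continuous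

end Padic

/-! ### §3 The place of `ℚ` below `w`, read off `p ∈ w` -/

section Under

variable (K : Type) [Field K] [NumberField K] (w : HeightOneSpectrum (𝓞 K)) {p : ℕ} [hp : Fact p.Prime]

/-- **If the rational prime `p` lies in `w`, then `w` lies over the place `(p)` of `ℚ`.** [cite: FrohlichTaylor1990, Ch. III §1 (1.14)(a)] -/
theorem liesOver_ratPlace_of_natCast_mem (hpw : ((p : ℕ) : 𝓞 K) ∈ w.asIdeal) :
    w.asIdeal.LiesOver (ratPlace p).asIdeal := by
  -- the place `u = w ∩ 𝓞_ℚ` of `ℚ` below `w` contains `p`, so `natGenerator u = p` and `u = (p)`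
  set u : HeightOneSpectrum (𝓞 ℚ) := w.under (𝓞 ℚ) with hu
  have hmem : ((p : ℕ) : 𝓞 ℚ) ∈ u.asIdeal := by
    rw [hu, HeightOneSpectrum.under_asIdeal, Ideal.under_def, Ideal.mem_comap, map_natCast]
    exact hpw
  have hdvd : natGenerator u ∣ p := by
    rw [natGenerator_dvd_iff, Ideal.mem_map_of_equiv]
    exact ⟨(p : 𝓞 ℚ), hmem, map_natCast _ p⟩
  have hgen : natGenerator u = p := (Nat.prime_dvd_prime_iff_eq (prime_natGenerator _) hp.out).mp hdvd
  have hup : primesEquiv (R := 𝓞 ℚ) u = ⟨p, hp.out⟩ := Subtype.ext hgen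
  have huv : u = ratPlace p := by
    rw [ratPlace, Equiv.eq_symm_apply, hup]
  refine ⟨?_⟩
  rw [← huv, hu, HeightOneSpectrum.under_asIdeal]

/-- ★★ **`𝒪_w ≃+* ℤ_[p]` for a place `w` of DEGREE ONE above the rational prime `p`** (`p ∈ w`,
`e(w|p) = f(w|p) = 1`) — the shape a consumer holding a split prime of an imaginary quadratic field meets
(`RayClassFieldAdicCharacterTower.mem_rayAdicTower_iff … (e : 𝒪_v ≃+* ℤ_[p])`).
[cite: deShalit1987, I.3.3 (p. 17), II.1.1 (p. 32)] [cite: FrohlichTaylor1990, Ch. III §1 (1.14)(a)] -/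
def padicIntEquivOfNatCastMem (hpw : ((p : ℕ) : 𝓞 K) ∈ w.asIdeal) (he : w.asIdeal.ramificationIdx (𝓞 ℚ) = 1)
    (hf : w.asIdeal.inertiaDeg (𝓞 ℚ) = 1) : w.adicCompletionIntegers K ≃+* ℤ_[p] :=
  haveI := liesOver_ratPlace_of_natCast_mem K w hpw
  padicIntEquivOfDegreeOne K p w he hf

/-- Continuity of `padicIntEquivOfNatCastMem`. [cite: FrohlichTaylor1990, Ch. III §1 (1.14)(a)] -/
theorem continuous_padicIntEquivOfNatCastMem (hpw : ((p : ℕ) : 𝓞 K) ∈ w.asIdeal)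
    (he : w.asIdeal.ramificationIdx (𝓞 ℚ) = 1) (hf : w.asIdeal.inertiaDeg (𝓞 ℚ) = 1) :
    Continuous (padicIntEquivOfNatCastMem K w hpw he hf) :=
  haveI := liesOver_ratPlace_of_natCast_mem K w hpw
  continuous_padicIntEquivOfDegreeOne K p w he hf

/-- Continuity of the inverse of `padicIntEquivOfNatCastMem`. [cite: FrohlichTaylor1990, Ch. III §1 (1.14)(a)] -/
theorem continuous_padicIntEquivOfNatCastMem_symm (hpw : ((p : ℕ) : 𝓞 K) ∈ w.asIdeal)
    (he : w.asIdeal.ramificationIdx (𝓞 ℚ) = 1) (hf : w.asIdeal.inertiaDeg (𝓞 ℚ) = 1) :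
    Continuous (padicIntEquivOfNatCastMem K w hpw he hf).symm :=
  haveI := liesOver_ratPlace_of_natCast_mem K w hpw
  continuous_padicIntEquivOfDegreeOne_symm K p w he hf

end Under

/-! ### §4 The split frame of a quadratic field: `p ∈ v`, `p ∈ v̄`, `v̄ ≠ v` ⟹ `e = f = 1` and `𝒪_v ≅ ℤ_p` -/

section Split

variable (K : Type) [Field K] [NumberField K] {p : ℕ} [hp : Fact p.Prime]

/-- Two places of `K` containing the rational prime `p` lie over the same place `(p)` of `ℚ`.
[cite: FrohlichTaylor1990, Ch. III §1 Thm. 20] -/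
theorem under_eq_under_of_natCast_mem {v vbar : HeightOneSpectrum (𝓞 K)}
    (hv : ((p : ℕ) : 𝓞 K) ∈ v.asIdeal) (hvbar : ((p : ℕ) : 𝓞 K) ∈ vbar.asIdeal) :
    v.under (𝓞 ℚ) = vbar.under (𝓞 ℚ) := by
  have h1 := (liesOver_ratPlace_of_natCast_mem K v hv).over
  have h2 := (liesOver_ratPlace_of_natCast_mem K vbar hvbar).over
  exact HeightOneSpectrum.ext (h1.symm.trans h2)

/-- **A SPLIT prime of a quadratic field has degree one**: `[K:ℚ] = 2`, `p ∈ v`, `p ∈ v̄`, `v̄ ≠ v` ⟹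
`e(v|p) = f(v|p) = 1` — the non-trivial automorphism moves `v` to `v̄` (transitivity of `Gal(K/ℚ)` on the
places above `p`), and a moved place of a quadratic extension has `e = f = 1` (tree
`ramificationIdx_eq_one_and_inertiaDeg_eq_one_of_smul_ne`, Fröhlich–Taylor III §1 Thm. 20: `2 = efg`, `g = 2`); the
same statement is proved Summits-side as `…Theorems.CycTangentCMCycTangentBoundAvatarRamified.degreeOne_of_ne` (cell
CycTangent), restated here at Literature level for importability. [cite: FrohlichTaylor1990, Ch. III §1 Thm. 20] -/
theorem ramificationIdx_eq_one_and_inertiaDeg_eq_one_of_natCast_mem_of_ne (hK2 : Module.finrank ℚ K = 2)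
    {v vbar : HeightOneSpectrum (𝓞 K)} (hv : ((p : ℕ) : 𝓞 K) ∈ v.asIdeal)
    (hvbar : ((p : ℕ) : 𝓞 K) ∈ vbar.asIdeal) (hne : vbar ≠ v) :
    v.asIdeal.ramificationIdx (𝓞 ℚ) = 1 ∧ v.asIdeal.inertiaDeg (𝓞 ℚ) = 1 := by
  haveI : Algebra.IsQuadraticExtension ℚ K := ⟨hK2⟩
  obtain ⟨σ, hσ⟩ := HeightOneSpectrum.exists_algEquiv_smul_eq (F := ℚ) (E := K)
    (under_eq_under_of_natCast_mem K hv hvbar)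
  have hσne : σ • v ≠ v := by rw [hσ]; exact hne
  exact ramificationIdx_eq_one_and_inertiaDeg_eq_one_of_smul_ne (F := ℚ) (E := K) σ hσne

/-- ★★ **`𝒪_v ≃+* ℤ_[p]` at a SPLIT prime of a quadratic field** (`[K:ℚ] = 2`, `p ∈ v`, `p ∈ v̄`, `v̄ ≠ v` — the
binders of the cell's frames, e.g. `K = ℚ(√-7)`, `2 = v v̄`): de Shalit's `𝒪_𝔭 = ℤ_p`.
[cite: deShalit1987, I.3.3 (p. 17), II.1.1 (p. 32)] [cite: FrohlichTaylor1990, Ch. III §1 (1.14)(a), Thm. 20] -/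
def padicIntEquivOfSplit (hK2 : Module.finrank ℚ K = 2) {v vbar : HeightOneSpectrum (𝓞 K)}
    (hv : ((p : ℕ) : 𝓞 K) ∈ v.asIdeal) (hvbar : ((p : ℕ) : 𝓞 K) ∈ vbar.asIdeal) (hne : vbar ≠ v) :
    v.adicCompletionIntegers K ≃+* ℤ_[p] :=
  padicIntEquivOfNatCastMem K v hv (ramificationIdx_eq_one_and_inertiaDeg_eq_one_of_natCast_mem_of_ne K hK2 hv hvbar hne).1
    (ramificationIdx_eq_one_and_inertiaDeg_eq_one_of_natCast_mem_of_ne K hK2 hv hvbar hne).2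

/-- Continuity of `padicIntEquivOfSplit`. [cite: FrohlichTaylor1990, Ch. III §1 (1.14)(a)] -/
theorem continuous_padicIntEquivOfSplit (hK2 : Module.finrank ℚ K = 2) {v vbar : HeightOneSpectrum (𝓞 K)}
    (hv : ((p : ℕ) : 𝓞 K) ∈ v.asIdeal) (hvbar : ((p : ℕ) : 𝓞 K) ∈ vbar.asIdeal) (hne : vbar ≠ v) :
    Continuous (padicIntEquivOfSplit K hK2 hv hvbar hne) :=
  continuous_padicIntEquivOfNatCastMem K v hv _ _

/-- Continuity of the inverse of `padicIntEquivOfSplit`. [cite: FrohlichTaylor1990, Ch. III §1 (1.14)(a)] -/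
theorem continuous_padicIntEquivOfSplit_symm (hK2 : Module.finrank ℚ K = 2) {v vbar : HeightOneSpectrum (𝓞 K)}
    (hv : ((p : ℕ) : 𝓞 K) ∈ v.asIdeal) (hvbar : ((p : ℕ) : 𝓞 K) ∈ vbar.asIdeal) (hne : vbar ≠ v) :
    Continuous (padicIntEquivOfSplit K hK2 hv hvbar hne).symm :=
  continuous_padicIntEquivOfNatCastMem_symm K v hv _ _

end Split

/-! ### §5 Field level: `K_w ≅ ℚ_p` at a place of degree one (the Coleman / Lubin–Tate junction `F := K_w`) -/

section Field

variable (K : Type) [Field K] [NumberField K] (p : ℕ) [hp : Fact p.Prime]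
  (w : HeightOneSpectrum (𝓞 K)) [w.asIdeal.LiesOver (ratPlace p).asIdeal]
  (he : w.asIdeal.ramificationIdx (𝓞 ℚ) = 1) (hf : w.asIdeal.inertiaDeg (𝓞 ℚ) = 1)

/-- ★ **`K_w ≃+* ℚ_[p]` at a place of degree one above `p`** (`[K_w : ℚ_p] = e f = 1`): the inverse of the tree's
`ℚ_{(p)} ≃+* K_w` composed with Mathlib's `Padic.adicCompletionEquiv : ℚ_[p] ≃A[ℚ] ℚ_{(p)}`.
[cite: FrohlichTaylor1990, Ch. III §1 (1.14)(a)] -/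
def padicEquivOfDegreeOne : w.adicCompletion K ≃+* ℚ_[p] :=
  (adicCompletionEquivOfDegreeOne ℚ K (ratPlace p) w he hf).symm.trans
    (Padic.adicCompletionEquiv (R := 𝓞 ℚ) ⟨p, hp.out⟩).symm.toAlgEquiv.toRingEquiv

/-- `K_w ≃+* ℚ_[p]` is continuous. [cite: FrohlichTaylor1990, Ch. III §1 (1.14)(a)] -/
theorem continuous_padicEquivOfDegreeOne : Continuous (padicEquivOfDegreeOne K p w he hf) :=
  (Padic.adicCompletionEquiv (R := 𝓞 ℚ) ⟨p, hp.out⟩).symm.continuous.comp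
    (continuous_adicCompletionEquivOfDegreeOne_symm ℚ K (ratPlace p) w he hf)

/-- Its inverse `ℚ_[p] ≃+* K_w` is continuous. [cite: FrohlichTaylor1990, Ch. III §1 (1.14)(a)] -/
theorem continuous_padicEquivOfDegreeOne_symm : Continuous (padicEquivOfDegreeOne K p w he hf).symm :=
  (continuous_adicCompletionEquivOfDegreeOne ℚ K (ratPlace p) w he hf).comp
    (Padic.adicCompletionEquiv (R := 𝓞 ℚ) ⟨p, hp.out⟩).continuous

/-- Unfolding `padicIntEquivOfDegreeOne` (definitional). [cite: FrohlichTaylor1990, Ch. III §1 (1.14)(a)] -/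
theorem padicIntEquivOfDegreeOne_apply (x : w.adicCompletionIntegers K) :
    padicIntEquivOfDegreeOne K p w he hf x =
      (PadicInt.adicCompletionIntegersEquiv (R := 𝓞 ℚ) ⟨p, hp.out⟩).symm
        (adicCompletionIntegersEquivOfDegreeOne K (ratPlace p) w he hf x) := by
  rw [padicIntEquivOfDegreeOne, RingEquiv.trans_apply]
  rfl

/-- Unfolding `padicEquivOfDegreeOne` (definitional). [cite: FrohlichTaylor1990, Ch. III §1 (1.14)(a)] -/
theorem padicEquivOfDegreeOne_apply (y : w.adicCompletion K) :
    padicEquivOfDegreeOne K p w he hf y =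
      (Padic.adicCompletionEquiv (R := 𝓞 ℚ) ⟨p, hp.out⟩).symm
        ((adicCompletionEquivOfDegreeOne ℚ K (ratPlace p) w he hf).symm y) := by
  rw [padicEquivOfDegreeOne, RingEquiv.trans_apply]
  rfl

/-- **Compatibility square**: the integer isomorphism `𝒪_w ≃+* ℤ_[p]` is the restriction of `K_w ≃+* ℚ_[p]`
(`(e𝒪 x : ℚ_p) = eK (x : K_w)`). [cite: FrohlichTaylor1990, Ch. III §1 (1.14)(a)] -/
theorem coe_padicIntEquivOfDegreeOne_apply (x : w.adicCompletionIntegers K) :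
    ((padicIntEquivOfDegreeOne K p w he hf x : ℤ_[p]) : ℚ_[p]) =
      padicEquivOfDegreeOne K p w he hf (x : w.adicCompletion K) := by
  rw [padicIntEquivOfDegreeOne_apply, padicEquivOfDegreeOne_apply,
    PadicInt.coe_adicCompletionIntegersEquiv_symm_apply, coe_adicCompletionIntegersEquivOfDegreeOne_apply]

/-- `K_w ≃+* ℚ_[p]` extends `K → K_w` / `ℚ → ℚ_p` compatibly: it sends the image of a rational `q` to `q`.
[cite: FrohlichTaylor1990, Ch. III §1 (1.14)(a)] -/
theorem padicEquivOfDegreeOne_ratCast (q : ℚ) :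
    padicEquivOfDegreeOne K p w he hf ((algebraMap ℚ K q : K) : w.adicCompletion K) = (q : ℚ_[p]) := by
  rw [padicEquivOfDegreeOne_apply]
  have h1 : (adicCompletionEquivOfDegreeOne ℚ K (ratPlace p) w he hf).symm
      ((algebraMap ℚ K q : K) : w.adicCompletion K) = algebraMap ℚ ((ratPlace p).adicCompletion ℚ) q := by
    apply (adicCompletionEquivOfDegreeOne ℚ K (ratPlace p) w he hf).injective
    rw [RingEquiv.apply_symm_apply]
    exact (adicCompletionEquivOfDegreeOne_coe ℚ K (ratPlace p) w he hf q).symm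
  rw [h1]
  exact ((Padic.adicCompletionEquiv (R := 𝓞 ℚ) ⟨p, hp.out⟩).symm.toAlgEquiv.commutes q).trans
    (eq_ratCast _ q)

end Field

end Literature.NumberTheory.NumberFields

end
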